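import Literature.NumberTheory.Transcendental.RoySmallValueMainC
import Literature.NumberTheory.Transcendental.RoySmallValueStep4
import HarnessLib

/-!
# Roy's small value estimate for `𝔾ₐ × 𝔾ₘ` — proof of Theorem 1.1, part D: Steps 3–5 at a good degree

Topic `Literature/NumberTheory/Transcendental`. Part of the formalisation of the proof of Roy 2013,
Theorem 1.1 (named fact `roy2013_thm_1_1`, `RoySmallValueEstimates.lean`). Source: D. Roy,
*A small value estimate for `𝔾ₐ × 𝔾ₘ`*, Mathematika 59 (2013) 333–363 = arXiv:1301.0663, §7,
Steps 3–5 (pp. 18–19 of the arXiv text):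

> **Step 3.** Denote by `D*` the smallest positive integer for which
> `Z ⊆ 𝒵(𝒟ⁱP̃_{D*+1} ; 0 ≤ i < 2⌊(D*+1)^τ⌋)`. [...] `deg(Z) ≤ 2(D*)^{2−τ}` and
> `h(Z) ≤ 7(D*)^{1+β−τ}`. **Step 4.** [...] for any subset `𝒮` of `𝒰`,
> `∑_{α∈𝒮} max{T* log dist(α,(1:γ)), log dist(α,A_γ)} ≥ −8(D*)^β deg(Z) − D* h(Z)`.
> **Step 5.** [...] `−(D^δ/25)(D^β deg Z + D h(Z)) ≥ −(T/T* + 1)(8(D*)^β deg Z + D* h(Z))` [...]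

Given a good degree `D` such that all degrees in `[D₂, D]` are good, a bound `B ∈ [D₂+1, D]`, and
the SEPARATION property "unit common zeros of `(P̃_E, Q_E)`, `D₂ ≤ E ≤ B`, are farther from
`(1:γ)` than `exp(−(κ/2)D^{δ+β}/T_D)`" (which holds for `D ≫_B 0`, part E), we run Steps 3–5:
`D' = D* + 1` is the least `E ∈ [D₂, D]` such that the `𝒟ⁱP̃_E` (`i < 2T_E`) vanish on the orbit
`Z_D` of part C; the separation forces `D' > B`; Proposition 6.4 transported to the degree `D'`
bounds `deg` and `h` of `Z_D`; the minimality gives `P* = 𝒟^{i₀}P̃_{D*}` non-vanishing on `Z_D`,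
to which Step 4 (`step4_sums`) applies at the degree `D*`; and Step 5 (`le_ratio_add_one_mul`,
seat B) yields the input inequality of the endgame (`main_step`). Everything is proved; the
constant `A₃ = 44 · 2^{1+β−τ}` is written out; no definitions, no named facts.

## References

* [Roy2013] D. Roy, *A small value estimate for 𝔾ₐ × 𝔾ₘ*, Mathematika 59 (2013), 333–363
  (arXiv:1301.0663), §7, Steps 3, 4, 5.
-/

noncomputable section

open MvPolynomial Finset Filter NumberField Height

namespace Literature.NumberTheory.Transcendental

namespace Roy2013

open Nesterenko

/-- `c₄ ≥ 1`. [folklore] -/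
theorem one_le_roy_c4 (ξ η : ℂ) : 1 ≤ roy_c4 ξ η := by
  have hc := one_le_roy_c2 ξ η
  have h1 : (1 : ℝ) ≤ Real.exp (2 * roy_c2 ξ η ^ 2) := Real.one_le_exp (by positivity)
  have h2 : (0 : ℝ) ≤ roy_A ξ η := by rw [roy_A]; positivity
  rw [roy_c4]
  nlinarith

namespace Setting

variable (S : Setting)

/-! ### Real-exponent bookkeeping -/

/-- `x^{2+β}/(T x) ≤ 2 x^{1+β−τ}` when `x^τ ≤ 2T`, `x ≥ 1`. [folklore] -/
theorem rpow_div_le {x T : ℝ} (hx : 1 ≤ x) (hT : 0 < T) (hTτ : x ^ S.τ ≤ 2 * T) :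
    x ^ (2 + S.β) / (T * x) ≤ 2 * x ^ (1 + S.β - S.τ) := by
  have hx0 : 0 < x := by linarith
  rw [div_le_iff₀ (mul_pos hT hx0)]
  have h1 : x ^ (2 + S.β) = x ^ (1 + S.β - S.τ) * x ^ S.τ * x := by
    rw [← Real.rpow_add hx0, ← Real.rpow_add_one hx0.ne']; congr 1; ring
  rw [h1]
  have h2 : 0 ≤ x ^ (1 + S.β - S.τ) := by positivity
  nlinarith [mul_le_mul_of_nonneg_left hTτ h2]

/-- `(y+1)^e ≤ 2^e y^e` for `y ≥ 1`, `e ≥ 0`. [folklore] -/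
theorem succ_rpow_le {y e : ℝ} (hy : 1 ≤ y) (he : 0 ≤ e) : (y + 1) ^ e ≤ 2 ^ e * y ^ e := by
  rw [← Real.mul_rpow (by norm_num) (by linarith)]
  exact Real.rpow_le_rpow (by linarith) (by linarith) he

/-! ### Steps 3–5 -/

set_option maxHeartbeats 1600000 in
/-- **Roy 2013, Steps 3–5 at a good degree** (see the module docstring): the data of the endgame.
[cite: Roy2013, §7, Steps 3, 4, 5] -/
theorem main_step {D : ℕ} (hG : S.Good D) {D₂ : ℕ} (hgood : ∀ E, D₂ ≤ E → E ≤ D → S.Good E)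
    {B : ℕ} (hB : D₂ + 1 ≤ B) (hBD : B ≤ D)
    (hsepB : ∀ E (hE : S.D₁ ≤ E), D₂ ≤ E → E ≤ B → ∀ α : Fin 3 → ℂ, ‖α‖ = 1 →
      eval α (S.Pc E) = 0 → eval α (map (Int.castRingHom ℂ) (levelQ E (S.Ptil E) (S.pkg E hE).t)) = 0 →
      Real.exp (-(κ / 2 * (D : ℝ) ^ S.δ * (D : ℝ) ^ S.β) / S.T D) < pdist S.ξ S.η α) :
    ∃ Ds d hZ T Ts : ℝ, 1 ≤ Ds ∧ Ds ≤ D ∧ 1 ≤ d ∧ 0 ≤ hZ ∧ hZ ≤ (44 * (2 : ℝ) ^ (1 + S.β - S.τ)) * Ds ^ (1 + S.β - S.τ) ∧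
      0 ≤ T ∧ T ≤ (D : ℝ) ^ S.τ ∧ 0 < Ts ∧ Ds ^ S.τ ≤ 2 * Ts ∧
      κ / 2 * (D : ℝ) ^ S.δ * ((D : ℝ) ^ S.β * d + D * hZ) ≤ (T / Ts + 1) * (5 * Ds ^ S.β * d + Ds * hZ) := by
  classical
  have hD₂D : D₂ ≤ D := by omega
  -- Step 2
  obtain ⟨i₀, hO⟩ := S.step2_out hG
  obtain ⟨j₀, hj₀U, hj₀⟩ := S.exists_close_point hG hO
  rw [mem_filter] at hj₀U
  obtain ⟨hj₀O, hj₀d⟩ := hj₀U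
  have hT0 : (0 : ℝ) < S.T D := by exact_mod_cast hG.one_le_T
  have hclose : pdist S.ξ S.η (unitRep ((S.Zc D hG.hD₁).α j₀)) ≤
      Real.exp (-(κ / 2 * (D : ℝ) ^ S.δ * (D : ℝ) ^ S.β) / S.T D) := by
    have hp : 0 < pdist S.ξ S.η (unitRep ((S.Zc D hG.hD₁).α j₀)) := S.pdist_pos D hG.hD₁ j₀
    rw [← Real.exp_log hp]
    refine Real.exp_le_exp.mpr ?_
    rw [le_div_iff₀ hT0, mul_comm]
    exact hj₀
  -- the vanishing predicate and `D'`
  let V : ℕ → Prop := fun E => ∀ x ∈ ((S.Zc D hG.hD₁).orb i₀), ∀ i < 2 * S.T E, aeval ((S.Zc D hG.hD₁).α x) (homD^[i] (S.Pc E)) = 0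
  have hVD : V D := fun x hx i hi => S.iterate_Pc_vanish hG hO hi x hx
  have hex : ∃ E, D₂ ≤ E ∧ E ≤ D ∧ V E := ⟨D, hD₂D, le_rfl, hVD⟩
  set D' := Nat.find hex with hD'def
  obtain ⟨hD₂D', hD'D, hVD'⟩ : D₂ ≤ D' ∧ D' ≤ D ∧ V D' := Nat.find_spec hex
  have hD'min : ∀ E, E < D' → ¬(D₂ ≤ E ∧ E ≤ D ∧ V E) := fun E hE => Nat.find_min hex hE
  have hG' : S.Good D' := hgood D' hD₂D' hD'D
  -- points of `O` are common zeros of `P̃_{E}, Q_{E}` whenever `V E`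
  have hcz : ∀ E (hE : S.Good E), V E → ∀ x ∈ ((S.Zc D hG.hD₁).orb i₀),
      eval ((S.Zc D hG.hD₁).α x) (S.Pc E) = 0 ∧
      eval ((S.Zc D hG.hD₁).α x) (map (Int.castRingHom ℂ) (levelQ E (S.Ptil E) (S.pkg E hE.hD₁).t)) = 0 := by
    intro E hE hV x hx
    have h2T : 0 < 2 * S.T E := by have := hE.one_le_T; omega
    refine ⟨hV x hx 0 h2T, ?_⟩
    change aeval ((S.Zc D hG.hD₁).α x) (map (Int.castRingHom ℂ) (levelQ E (S.Ptil E) (S.pkg E hE.hD₁).t)) = 0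
    rw [map_levelQ, map_sum]
    refine Finset.sum_eq_zero fun i hi => ?_
    rw [mem_Icc] at hi
    have hET := S.le_T E
    rw [map_smul, hV x hx i (by omega), smul_zero]
  -- `D' > B` by separation
  have hD'B : B < D' := by
    by_contra hle
    push Not at hle
    obtain ⟨hP0, hQ0⟩ := hcz D' hG' hVD' j₀ hj₀O
    have hs : ((‖(S.Zc D hG.hD₁).α j₀‖⁻¹ : ℝ) : ℂ) ≠ 0 :=
      Complex.ofReal_ne_zero.mpr (inv_ne_zero (norm_ne_zero_iff.mpr ((S.Zc D hG.hD₁).α_ne_zero j₀)))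
    have hsep := hsepB D' hG'.hD₁ hD₂D' hle (unitRep ((S.Zc D hG.hD₁).α j₀)) (norm_unitRep ((S.Zc D hG.hD₁).α_ne_zero j₀))
      (by rw [unitRep, eval_smul_eq_zero_iff (S.isHomogeneous_Pc hG'.hD₀) hs]; exact hP0)
      (by rw [unitRep, eval_smul_eq_zero_iff (isHomogeneous_map_levelQ (S.isHomogeneous_Pc hG'.hD₀) _) hs]
          exact hQ0)
    exact absurd hclose (not_le.mpr hsep)
  -- `D* = D' − 1`
  set Ds := D' - 1 with hDsdef
  have hDs₂ : D₂ ≤ Ds := by omega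
  have hDsD : Ds ≤ D := by omega
  have hDsD' : Ds < D' := by omega
  have hD'eq : D' = Ds + 1 := by omega
  have hGs : S.Good Ds := hgood Ds hDs₂ hDsD
  -- `P*`
  have hnotV : ¬V Ds := fun hV => hD'min Ds hDsD' ⟨hDs₂, hDsD, hV⟩
  obtain ⟨x₁, hx₁, i₁, hi₁, hne⟩ : ∃ x ∈ ((S.Zc D hG.hD₁).orb i₀), ∃ i < 2 * S.T Ds, aeval ((S.Zc D hG.hD₁).α x) (homD^[i] (S.Pc Ds)) ≠ 0 := by
    by_contra hcon; push Not at hcon; exact hnotV hcon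
  set Pz : MvPolynomial (Fin 3) ℤ := (homDK ℤ)^[i₁] (S.Ptil Ds) with hPzdef
  have hPzmap : map (Int.castRingHom ℂ) Pz = homD^[i₁] (S.Pc Ds) := by rw [hPzdef, map_iterate_homDK]
  have hPzhom : (map (Int.castRingHom ℂ) Pz).IsHomogeneous Ds := by
    rw [hPzmap]; exact isHomogeneous_iterate_homD (S.isHomogeneous_Pc hGs.hD₀) i₁
  have hnz : ∀ j ∈ ((S.Zc D hG.hD₁).orb i₀), eval ((S.Zc D hG.hD₁).α j) (map (Int.castRingHom ℂ) Pz) ≠ 0 := by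
    intro j hj h0
    -- vanishing propagates along the orbit, reaching `x₁`
    have hx₁' : x₁ ∈ (S.Zc D hG.hD₁).orb j := by rw [(S.Zc D hG.hD₁).orb_eq_of_mem hj]; exact hx₁
    obtain ⟨-, g, rfl⟩ := mem_filter.mp hx₁'
    have := eval_perm_eq_zero_of_eval_eq_zero (S.Zc D hG.hD₁) Pz h0 g
    rw [hPzmap] at this
    exact hne this
  -- Prop. 6.4 at the degree `D'`
  have hGmem : ∀ j ∈ ((S.Zc D hG.hD₁).orb i₀), (S.pkg D hG.hD₁).α j 0 ≠ 0 ∧ (S.pkg D hG.hD₁).α j 2 ≠ 0 := by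
    intro j hj
    rcases inG_or_special (S.isHomogeneous_Pc hG'.hD₀) (S.not_X_zero_dvd_Pc hG'.hD₀)
      (S.not_X_two_dvd_Pc hG'.hD₀) ((S.pkg D hG.hD₁).piv_one j) ((S.pkg D hG.hD₁).piv_min j)
      (fun i hi => hVD' j hj i (by have := S.le_T D'; omega)) with h | h
    · exact h
    · exact absurd h ((S.Zc D hG.hD₁).not_special_of_mem_orb hj hj₀O hj₀d)
  have h64 := prop_6_4_transported (S.pkg D hG.hD₁) (S.pkg D' hG'.hD₁) (K := S.Kfld D)
    (S.mem_Kfld hG.hD₁ le_rfl) (S.mem_Kfld hG'.hD₁ hD'D) i₀ (S.choose_lt_T hG'.one_le)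
    (S.T_le_choose D') hG'.L_lt (S.le_T D') (S.isHomogeneous_Pc hG'.hD₀) hVD' hGmem
  have hlogF := S.log_l1Norm_royF_le hG'
  -- the numbers
  set d : ℝ := (((S.Zc D hG.hD₁).orb i₀).card : ℝ) with hddef
  set hZr : ℝ := ∑ j ∈ ((S.Zc D hG.hD₁).orb i₀), hgtK (S.Zc D hG.hD₁) j with hhZdef
  have hd1 : 1 ≤ d := by
    rw [hddef]; exact_mod_cast Finset.card_pos.mpr ⟨i₀, (S.Zc D hG.hD₁).self_mem_orb i₀⟩
  have hhZ0 : 0 ≤ hZr := Finset.sum_nonneg fun j _ => hgtK_nonneg _ j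
  have hDs1 : (1 : ℝ) ≤ Ds := by exact_mod_cast hGs.one_le
  have hDs0 : (0 : ℝ) < Ds := by linarith
  have hD'1 : (1 : ℝ) ≤ D' := by exact_mod_cast hG'.one_le
  have hD'0 : (0 : ℝ) < D' := by linarith
  have hT'0 : (0 : ℝ) < S.T D' := by exact_mod_cast hG'.one_le_T
  have hTs0 : (0 : ℝ) < S.T Ds := by exact_mod_cast hGs.one_le_T
  have hnK : (0 : ℝ) < Module.finrank ℚ (S.Kfld D) := finrank_pos_real
  have hD'2Ds : (D' : ℝ) = Ds + 1 := by rw [hD'eq]; push_cast; ring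
  -- degree bound `d ≤ 8 Ds^{2−τ}`
  have hdle : d ≤ 8 * (Ds : ℝ) ^ (2 - S.τ) := by
    have h1' : (S.T D' : ℝ) * d ≤ (D' : ℝ) ^ 2 := by rw [hddef]; exact_mod_cast h64.1
    have h2' : d ≤ (D' : ℝ) ^ (2 : ℝ) / S.T D' := by
      rw [le_div_iff₀ hT'0, Real.rpow_two]; linarith
    have h3' : (D' : ℝ) ^ (2 : ℝ) / S.T D' ≤ 2 * (D' : ℝ) ^ (2 - S.τ) := by
      rw [div_le_iff₀ hT'0]
      have h4 : (D' : ℝ) ^ (2 : ℝ) = (D' : ℝ) ^ (2 - S.τ) * (D' : ℝ) ^ S.τ := by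
        rw [← Real.rpow_add hD'0]; congr 1; ring
      rw [h4]
      have := hG'.hTτ
      have h5 : 0 ≤ (D' : ℝ) ^ (2 - S.τ) := by positivity
      nlinarith [mul_le_mul_of_nonneg_left this h5]
    have h6 : (D' : ℝ) ^ (2 - S.τ) ≤ 2 ^ (2 - S.τ) * (Ds : ℝ) ^ (2 - S.τ) := by
      rw [hD'2Ds]; exact succ_rpow_le hDs1 (by linarith [S.hτ2])
    have h7 : (2 : ℝ) ^ (2 - S.τ) ≤ 2 := by
      calc (2 : ℝ) ^ (2 - S.τ) ≤ 2 ^ (1 : ℝ) :=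
            Real.rpow_le_rpow_of_exponent_le (by norm_num) (by linarith [S.hτ1])
        _ = 2 := Real.rpow_one _
    have h8 : 0 ≤ (Ds : ℝ) ^ (2 - S.τ) := by positivity
    nlinarith [mul_le_mul_of_nonneg_right h7 h8]
  -- height bound `hZ ≤ A₃ Ds^{1+β−τ}`
  have hhZle : hZr ≤ (44 * (2 : ℝ) ^ (1 + S.β - S.τ)) * (Ds : ℝ) ^ (1 + S.β - S.τ) := by
    have h1' : (S.T D' : ℝ) * D' * ∑ j ∈ ((S.Zc D hG.hD₁).orb i₀), logHeight ((S.Zc D hG.hD₁).rep j) ≤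
        Module.finrank ℚ (S.Kfld D) * (22 * (D' : ℝ) ^ (2 + S.β)) :=
      h64.2.trans (mul_le_mul_of_nonneg_left hlogF hnK.le)
    have h2' : ∑ j ∈ ((S.Zc D hG.hD₁).orb i₀), logHeight ((S.Zc D hG.hD₁).rep j) = Module.finrank ℚ (S.Kfld D) * hZr := by
      rw [hhZdef, Finset.mul_sum]
      exact Finset.sum_congr rfl fun j _ => by rw [hgtK]; field_simp
    rw [h2'] at h1'
    have h3' : (S.T D' : ℝ) * D' * hZr ≤ 22 * (D' : ℝ) ^ (2 + S.β) := by
      refine le_of_mul_le_mul_left ?_ hnK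
      calc (Module.finrank ℚ (S.Kfld D) : ℝ) * ((S.T D' : ℝ) * D' * hZr)
          = (S.T D' : ℝ) * D' * (Module.finrank ℚ (S.Kfld D) * hZr) := by ring
        _ ≤ Module.finrank ℚ (S.Kfld D) * (22 * (D' : ℝ) ^ (2 + S.β)) := h1'
    have h4' : hZr ≤ 22 * ((D' : ℝ) ^ (2 + S.β) / (S.T D' * D')) := by
      rw [mul_div_assoc', le_div_iff₀ (mul_pos hT'0 hD'0)]
      linarith
    have h5' := S.rpow_div_le hD'1 hT'0 hG'.hTτ
    have h6' : (D' : ℝ) ^ (1 + S.β - S.τ) ≤ 2 ^ (1 + S.β - S.τ) * (Ds : ℝ) ^ (1 + S.β - S.τ) := by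
      rw [hD'2Ds]; exact succ_rpow_le hDs1 (by linarith [S.hτβ])
    nlinarith
  -- Step 4 at the degree `Ds`
  have hmemP : homD^[i₁] (S.Pc Ds) ∈ S.body Ds := S.iterate_Pc_mem_body hGs.hD₀ hGs.one_le hGs.hA1 hGs.hA2 hi₁
  have hΛ : l1Norm (map (Int.castRingHom ℂ) Pz) ≤ Real.exp (S.Y Ds) := by
    rw [hPzmap]; exact S.l1Norm_iterate_Pc_le hGs.hD₀ hGs.one_le hGs.hA1 hi₁.le
  have hYs : 0 < S.Y Ds := S.Y_pos hGs.one_le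
  have hΛ1 : 1 ≤ Real.exp (S.Y Ds) := Real.one_le_exp hYs.le
  have hBv : ∀ n < S.T Ds, ‖aeval ![1, S.ξ, S.η] (homD^[n] (map (Int.castRingHom ℂ) Pz))‖ ≤ Real.exp (-S.U Ds) := by
    intro n hn; rw [hPzmap]; exact hmemP.2.2 n hn
  have hpd0 : ∀ j ∈ ((S.Zc D hG.hD₁).orb i₀), 0 < pdist S.ξ S.η (unitRep ((S.Zc D hG.hD₁).α j)) := fun j _ => S.pdist_pos D hG.hD₁ j
  -- the common `b`
  set b : Fin (S.pkg D hG.hD₁).m → ℝ := fun j => if adist S.ξ S.η (unitRep ((S.Zc D hG.hD₁).α j)) = 0 then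
    ((S.T D : ℝ) + S.T Ds) * Real.log (pdist S.ξ S.η (unitRep ((S.Zc D hG.hD₁).α j))) - 1
    else Real.log (adist S.ξ S.η (unitRep ((S.Zc D hG.hD₁).α j))) with hbdef
  have hb1 : ∀ j ∈ ((S.Zc D hG.hD₁).orb i₀), pdist S.ξ S.η (unitRep ((S.Zc D hG.hD₁).α j)) ≤ (2 * roy_c2 S.ξ S.η)⁻¹ →
      adist S.ξ S.η (unitRep ((S.Zc D hG.hD₁).α j)) ≠ 0 → b j = Real.log (adist S.ξ S.η (unitRep ((S.Zc D hG.hD₁).α j))) := by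
    intro j _ _ h; show (if _ then _ else _) = _; rw [if_neg h]
  have hb0 : ∀ j ∈ ((S.Zc D hG.hD₁).orb i₀), pdist S.ξ S.η (unitRep ((S.Zc D hG.hD₁).α j)) ≤ (2 * roy_c2 S.ξ S.η)⁻¹ →
      adist S.ξ S.η (unitRep ((S.Zc D hG.hD₁).α j)) = 0 → b j ≤ S.T D * Real.log (pdist S.ξ S.η (unitRep ((S.Zc D hG.hD₁).α j))) := by
    intro j hj hd h
    show (if _ then _ else _) ≤ _
    rw [if_pos h]
    have hc := one_le_roy_c2 S.ξ S.η
    have ha : Real.log (pdist S.ξ S.η (unitRep ((S.Zc D hG.hD₁).α j))) ≤ 0 := by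
      apply Real.log_nonpos (pdist_nonneg _ _ _)
      refine hd.trans ?_
      rw [inv_le_one₀ (by positivity)]; linarith
    nlinarith [hTs0.le]
  -- `hsmall`
  have hsmall : 2 * (Real.exp (2 * roy_c2 S.ξ S.η ^ 2) * Real.exp (-S.U Ds)) ≤
      Real.exp (-(Ds * ∑ j ∈ ((S.Zc D hG.hD₁).orb i₀), hgtK (S.Zc D hG.hD₁) j + ((S.Zc D hG.hD₁).orb i₀).card * Real.log (Real.exp (S.Y Ds)))) := by
    rw [Real.log_exp, ← hhZdef, ← hddef]
    have h2' : (Ds : ℝ) * (Ds : ℝ) ^ (1 + S.β - S.τ) = (Ds : ℝ) ^ (2 + S.β - S.τ) := by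
      rw [← Real.rpow_one_add' hDs0.le (by linarith [S.hτβ])]; congr 1; ring
    have h3' : (Ds : ℝ) ^ (2 - S.τ) * (Ds : ℝ) ^ S.β = (Ds : ℝ) ^ (2 + S.β - S.τ) := by
      rw [← Real.rpow_add hDs0]; congr 1; ring
    have e1 : (Ds : ℝ) * hZr ≤ (44 * (2 : ℝ) ^ (1 + S.β - S.τ)) * (Ds : ℝ) ^ (2 + S.β - S.τ) := by
      calc (Ds : ℝ) * hZr ≤ Ds * ((44 * (2 : ℝ) ^ (1 + S.β - S.τ)) * (Ds : ℝ) ^ (1 + S.β - S.τ)) :=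
            mul_le_mul_of_nonneg_left hhZle hDs0.le
        _ = (44 * (2 : ℝ) ^ (1 + S.β - S.τ)) * ((Ds : ℝ) * (Ds : ℝ) ^ (1 + S.β - S.τ)) := by ring
        _ = (44 * (2 : ℝ) ^ (1 + S.β - S.τ)) * (Ds : ℝ) ^ (2 + S.β - S.τ) := by rw [h2']
    have e2 : d * S.Y Ds ≤ 16 * (Ds : ℝ) ^ (2 + S.β - S.τ) := by
      rw [Setting.Y]
      have hb : (0 : ℝ) ≤ 2 * (Ds : ℝ) ^ S.β := by positivity
      calc d * (2 * (Ds : ℝ) ^ S.β) ≤ (8 * (Ds : ℝ) ^ (2 - S.τ)) * (2 * (Ds : ℝ) ^ S.β) :=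
            mul_le_mul_of_nonneg_right hdle hb
        _ = 16 * ((Ds : ℝ) ^ (2 - S.τ) * (Ds : ℝ) ^ S.β) := by ring
        _ = 16 * (Ds : ℝ) ^ (2 + S.β - S.τ) := by rw [h3']
    have h4 : Real.log 2 + 2 * roy_c2 S.ξ S.η ^ 2 + ((44 * (2 : ℝ) ^ (1 + S.β - S.τ)) + 16) * (Ds : ℝ) ^ (2 + S.β - S.τ) ≤ S.U Ds := by
      exact hGs.hstep4
    have h5 : Real.log 2 + 2 * roy_c2 S.ξ S.η ^ 2 + -S.U Ds ≤ -((Ds : ℝ) * hZr + d * S.Y Ds) := by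
      linarith
    calc 2 * (Real.exp (2 * roy_c2 S.ξ S.η ^ 2) * Real.exp (-S.U Ds))
        = Real.exp (Real.log 2 + 2 * roy_c2 S.ξ S.η ^ 2 + -S.U Ds) := by
          rw [Real.exp_add, Real.exp_add, Real.exp_log two_pos]; ring
      _ ≤ Real.exp (-((Ds : ℝ) * hZr + d * S.Y Ds)) := Real.exp_le_exp.mpr h5
  -- Step 4
  have h4 : ∀ S' ⊆ ((S.Zc D hG.hD₁).orb i₀).filter (fun j => pdist S.ξ S.η (unitRep ((S.Zc D hG.hD₁).α j)) ≤ (2 * roy_c2 S.ξ S.η)⁻¹),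
      -(5 * (Ds : ℝ) ^ S.β * d + Ds * hZr) ≤
        ∑ j ∈ S', max (S.T Ds * Real.log (pdist S.ξ S.η (unitRep ((S.Zc D hG.hD₁).α j)))) (b j) := by
    intro S' hS'
    have hst := step4_sums (S.Zc D hG.hD₁) i₀ hPzhom hnz hΛ1 hΛ (Real.exp_pos _).le hBv hsmall hpd0 b hb1 hS'
    rw [Real.log_exp] at hst
    refine le_trans ?_ hst
    rw [← hhZdef, ← hddef, neg_le_neg_iff]
    have hS'card : (S'.card : ℝ) ≤ d := by
      rw [hddef]; exact_mod_cast (Finset.card_le_card hS').trans (Finset.card_filter_le _ _)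
    have hE₄ := hGs.hE₄
    have hlog4 : 0 ≤ Real.log (4 * (Real.exp (S.Y Ds) * roy_c4 S.ξ S.η ^ Ds)) := by
      refine Real.log_nonneg ?_
      have h1' : (1 : ℝ) ≤ roy_c4 S.ξ S.η ^ Ds := one_le_pow₀ (one_le_roy_c4 S.ξ S.η)
      nlinarith
    have hc4 : 0 < roy_c4 S.ξ S.η ^ Ds := pow_pos (roy_c4_pos _ _) _
    have hlogeq : Real.log (4 * (Real.exp (S.Y Ds) * roy_c4 S.ξ S.η ^ Ds)) =
        Real.log 4 + S.Y Ds + Ds * Real.log (roy_c4 S.ξ S.η) := by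
      rw [Real.log_mul (by norm_num) (mul_pos (Real.exp_pos _) hc4).ne',
        Real.log_mul (Real.exp_pos _).ne' hc4.ne', Real.log_exp, Real.log_pow]
      ring
    rw [Setting.Y] at hlogeq hE₄ ⊢
    rw [hlogeq]
    have hβ0 : 0 ≤ (Ds : ℝ) ^ S.β := by positivity
    nlinarith [mul_le_mul_of_nonneg_right hS'card hlog4, mul_le_mul_of_nonneg_left hE₄ (by linarith : (0:ℝ) ≤ d)]
  -- Step 2 display with this `b`
  have h2 := S.step2_h2 hG hO b hb0 hb1
  -- Step 5
  have h5 := le_ratio_add_one_mul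
    (((S.Zc D hG.hD₁).orb i₀).filter (fun j => pdist S.ξ S.η (unitRep ((S.Zc D hG.hD₁).α j)) ≤ (2 * roy_c2 S.ξ S.η)⁻¹))
    (fun j => Real.log (pdist S.ξ S.η (unitRep ((S.Zc D hG.hD₁).α j)))) b hT0.le hTs0
    (L := κ / 2 * (D : ℝ) ^ S.δ * ((D : ℝ) ^ S.β * d + D * hZr))
    (R := 5 * (Ds : ℝ) ^ S.β * d + Ds * hZr) (by rw [hddef, hhZdef]; exact h2) h4
  refine ⟨Ds, d, hZr, S.T D, S.T Ds, hDs1, by exact_mod_cast hDsD, hd1, hhZ0, hhZle, hT0.le, S.T_le D,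
    hTs0, hGs.hTτ, h5⟩

end Setting

end Roy2013

end Literature.NumberTheory.Transcendental
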